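import Literature.LinearAlgebra.DirectLimit.BilinFormOfCompatibleFamily
import Literature.NumberTheory.Automorphic.Liu2021.AppendixC.EtaleHeckeDatumOfTranslates
import HarnessLib

/-!
# [Liu 2021, §4.2] a bilinear form on the étale tower `H¹_ét(A_∞ ⊗_E Ē, ℚ_ℓ) = colim_K (V_ℓ A_K)^∨` from a compatible family of level
# forms — existence, uniqueness, and invariance under the Hecke translates and the Galois action («the form on the tower», ∃-form)

Topic `NumberTheory/Automorphic/Liu2021/AppendixC`; namespaces `Literature.NumberTheory.Automorphic.Liu2021.AppendixC.Sec42Data` (§1–§2, §4–§6)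
and `….Sec42Data.HeckeTranslates` (§3, §7).  THEOREMS ONLY (no definition, no named fact, no instance, no `sorry`); the form is delivered
in `∃`-form.  Cell `hodgecm-mathlib` (D-0151), fan A, count-neutral capital (`--supports stmt-HodgeConjecture-24832`): leg (T2b) of the
tower road (P) toward the S2′ socket `SocketRos` (A-p07 (g12) census `CENSUS-RoadP-P2P3-currency` §3; A-plan2 (g12) word 2026-08-30T02:49:06Z;
socket block on the bus 02:55:46Z).  HC_CM is proved only modulo the 7 printed citations until rung 0 closes; nothing of [Liu2021] is asserted
here — the file is plumbing on the tree's CONSTRUCTED tower (★ `EtaleH1Tower`, ★ `EtaleHeckeDatumOfTranslates`).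

Print.  [Liu2021] §4.2 (print pp. 49–50): l. 2070–2074 «By functoriality, we obtain a projective system `{A_K}_K` … The Hecke correspondences provide a homomorphism
`𝔾(𝔸_F^∞) → Aut_E(A_∞)`», l. 2158–2160 «`H¹_ét(A_∞ ⊗ …) := colim_K H¹_ét(A_K ⊗ …)` … a `ℚ_ℓ^{ac}[Gal(ℂ/τ'(E)) × 𝔾(𝔸_F^∞)]`-module».  The
tree types the colimit as `C.etaleH1Tower ℓ = Module.DirectLimit (C.etSysObj ℓ) (C.etSys ℓ)` over the reversed level index `RestOne.Idx C`
(transitions `ᵗV_ℓ(Alb_u)`, ★ `etSys`), the classes `C.toTower ℓ K`, the Galois action `C.towerRep ℓ` and the Hecke action of a choice of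
translates `T.etHeckeRep ℓ` with its defining formula ★ `etHeckeRep_toTower : g · [φ]_K = [ᵗV_ℓ(Alb T_g) φ]_L` (`g⁻¹Lg ⊆ K`).  INPUT of this file
(produced elsewhere — for the road (P) by the canonical polarisations `Θ_K` and their `ℓ`-adic Weil pairings, (P1)/(P2)): a family of bilinear
forms `e K` on the levels `C.etaleH1 ℓ K = (V_ℓ A_K)^∨`, weights `w K : ℚ_ℓ` (the consumer takes `w K = [K₀ : K]⁻¹`), and ONE law
`hT : w L • e L (ᵗV_ℓ(Alb T_g) φ, ᵗV_ℓ(Alb T_g) ψ) = w K • e K (φ, ψ)` for every translate `T_g : X_L → X_K` (`g⁻¹Lg ⊆ K`); at `g = 1` (★ `albTr_one`)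
this is the compatibility with the transitions `Alb_u`, at general `g` it is the invariance under the translates.  OUTPUT: a bilinear form `B` on
the tower with `B ([φ]_K, [ψ]_K) = w K • e K (φ, ψ)`, unique, `etHeckeRep`-invariant, `towerRep`-equivariant up to a character, separating when the
`e K` are — the object on which (T3) reads «`ι(heckeEnd g)` is the `B`-adjoint of `[KgK]`, namely `[Kg⁻¹K]`» (with ★ `HeckeOperatorAdjointBilinear`).

* §1 `toTower_eq_of` (`rfl` bridge to `Module.DirectLimit.of`); **`exists_bilinForm_toTower`** — existence from the `g = 1` law alone
  (generic ★ `Literature.LinearAlgebra.DirectLimit.exists_bilin_of_compatible`, [BourbakiAlgebraI1989, II §6 no. 2 Prop. 6 / no. 3 Prop. 7]).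
* §2 `bilinForm_ext_toTower` — uniqueness from the values on same-level classes; `bilinForm_toTower_toTower` — the cross-level formula at a common
  refinement `L ⊆ K, K'`.
* §3 **`HeckeTranslates.bilinForm_etHeckeRep`** — `B (g·x, g·y) = B (x, y)` for every `g ∈ 𝔾(𝔸_F^∞)`, from `hT` and ★ `etHeckeRep_toTower` at the
  admissible level `L = gKg⁻¹ ∩ K₀` (★ `C5.heckeLevel`).
* §4 `bilinForm_towerRep` — `B (σ·x, σ·y) = χ σ • B (x, y)` from a level-wise `χ`-equivariance of the `e K` (★ `towerRep_toTower`).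
* §5 `bilinForm_separatingLeft` / `bilinForm_separatingRight` — separation from level-wise separation and `w K ≠ 0`.
* §6 `bilinForm_comm` / `bilinForm_self_eq_zero` — symmetry / alternation from the levels.
* §7 **`HeckeTranslates.exists_bilinForm_etaleH1Tower`** — the PACKAGED socket: `∃ B, (∀ K φ ψ, B ([φ]_K, [ψ]_K) = w K • e K (φ, ψ)) ∧
  ∀ g x y, B (g·x, g·y) = B (x, y)`.

## References
* [Liu2021] Y. Liu, *Fourier–Jacobi cycles and arithmetic relative trace formula*, Camb. J. Math. 9 (2021) (`FJcycle.tex`): §4.2 «Albanese of unitary Shimura varieties» l. 2066–2081 and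
  l. 2152–2160 (print pp. 49–50).
* [BourbakiAlgebraI1989] N. Bourbaki, *Algebra I, Chapters 1–3* (Springer 1989), Ch. II §6 no. 2 Prop. 6 (p. 288), no. 3 Prop. 7 (p. 289–290).
* Tree: ★ `AppendixC.EtaleH1Tower` (`etaleH1`, `etSys`, `etaleH1Tower`, `toTower`, `towerRep`, `towerRep_toTower`), ★ `AppendixC.EtaleHeckeDatumOfTranslates`
  (`directedSystem_etSys`, `etHeckeRep`, `etHeckeRep_toTower`), ★ `AppendixC.HeckeTranslates` (`albTr`, `albTr_one`), ★ `AppendixC.PropC5`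
  (`C5.HeckeLE`, `C5.heckeLevel`, `C5.heckeLE_heckeLevel`), ★ `AppendixC.RestOneLevelInvariants` (`RestOne.isDirectedOrder_idx`, `nonempty_idx`),
  ★ `Literature.LinearAlgebra.DirectLimit.BilinFormOfCompatibleFamily` ((T2a): `exists_bilin_of_compatible`, `bilin_ext_of`, `bilin_apply_of_of`,
  `bilin_map_map_of`, `bilin_map_map_of'`, `bilin_separatingLeft_of`, `bilin_separatingRight_of`, `bilin_comm_of`, `bilin_self_eq_zero_of`).
-/

set_option autoImplicit false

open CategoryTheory NumberField

namespace Literature.NumberTheory.Automorphic.Liu2021.AppendixC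

open Literature.AlgebraicGeometry.Motives (AbelianVariety)
open Literature.AlgebraicGeometry.Motives.AbelianVariety (rationalTateModuleMap)
open Literature.LinearAlgebra.DirectLimit

variable {F E : Type} [Field F] [NumberField F] [IsTotallyReal F] [Field E] [NumberField E] [Algebra F E]
  [IsTotallyComplex E] [Algebra.IsQuadraticExtension F E]
variable {P5 : PropC5Data F E} {isotropicAt : ℕ → Prop}

namespace Sec42Data

variable (C : Sec42Data P5 isotropicAt) (ℓ : ℕ) [Fact ℓ.Prime]

open RestOne (Idx)
open scoped Classical

/-! ## §1 Existence from the compatibility with the transitions -/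

/-- The canonical map `[·]_K : H¹_ét(A_K) → H¹_ét(A_∞)` is `Module.DirectLimit.of` at the reversed index `K` (by `rfl`; bridge to the generic
direct-limit lemmas). [cite: Liu2021, §4.2 (FJcycle.tex l. 2158; print pp. 49–50)] -/
theorem toTower_eq_of (K : C5.SmallLevel C.S.K₀) (φ : C.etaleH1 ℓ K) :
    C.toTower ℓ K φ = Module.DirectLimit.of ℚ_[ℓ] (Idx C) (C.etSysObj ℓ) (C.etSys ℓ) (OrderDual.toDual K) φ :=
  rfl

/-- **A compatible family of level forms defines a bilinear form on `H¹_ét(A_∞)`**: given bilinear forms `e K` on the levels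
`H¹_ét(A_K) = (V_ℓ A_K)^∨`, weights `w K`, and the compatibility `w L • e L (ᵗV_ℓ(Alb_u) φ, ᵗV_ℓ(Alb_u) ψ) = w K • e K (φ, ψ)` with every
transition `Alb_u : A_L → A_K` (`L ⊆ K`), there is a bilinear form `B` on the colimit with `B ([φ]_K, [ψ]_K) = w K • e K (φ, ψ)` at every level
(the direct system of levels is directed, ★ `RestOne.isDirectedOrder_idx`; passage to the limit [BourbakiAlgebraI1989, II §6 no. 3 Prop. 7] via
★ `Literature.LinearAlgebra.DirectLimit.exists_bilin_of_compatible`).  Ours, on the tree's tower.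
[cite: Liu2021, §4.2 (FJcycle.tex l. 2070–2072 and l. 2158; print pp. 49–50)] [cite: BourbakiAlgebraI1989, Ch. II §6 no. 3 Prop. 7 (p. 289–290)] -/
theorem exists_bilinForm_toTower
    (e : ∀ K : C5.SmallLevel C.S.K₀, LinearMap.BilinForm ℚ_[ℓ] (C.etaleH1 ℓ K)) (w : C5.SmallLevel C.S.K₀ → ℚ_[ℓ])
    (h1 : ∀ {L K : C5.SmallLevel C.S.K₀} (f : L ⟶ K) (φ ψ : C.etaleH1 ℓ K),
      w L • e L ((rationalTateModuleMap ℓ (C.Atr f)).dualMap φ) ((rationalTateModuleMap ℓ (C.Atr f)).dualMap ψ) = w K • e K φ ψ) :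
    ∃ B : LinearMap.BilinForm ℚ_[ℓ] (C.etaleH1Tower ℓ),
      ∀ (K : C5.SmallLevel C.S.K₀) (φ ψ : C.etaleH1 ℓ K), B (C.toTower ℓ K φ) (C.toTower ℓ K ψ) = w K • e K φ ψ := by
  haveI := RestOne.isDirectedOrder_idx C
  haveI := RestOne.nonempty_idx C
  haveI := C.directedSystem_etSys ℓ
  obtain ⟨B, hB, -⟩ := exists_bilin_of_compatible (f := C.etSys ℓ) (P := ℚ_[ℓ])
    (fun i : Idx C => w (OrderDual.ofDual i) • e (OrderDual.ofDual i)) (fun i j hij x y => by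
      simp only [LinearMap.smul_apply]
      exact h1 (homOfLE (show OrderDual.ofDual j ≤ OrderDual.ofDual i from hij)) x y)
  exact ⟨B, fun K φ ψ => hB (OrderDual.toDual K) φ ψ⟩

/-! ## §2 Uniqueness and the cross-level formula -/

/-- **Uniqueness**: a bilinear form on `H¹_ét(A_∞)` is determined by its values on same-level pairs of classes `([φ]_K, [ψ]_K)` (every class is a
level class and the index is directed; ★ `Literature.LinearAlgebra.DirectLimit.bilin_ext_of`).  Ours.
[cite: Liu2021, §4.2 (FJcycle.tex l. 2158; print pp. 49–50)] [cite: BourbakiAlgebraI1989, Ch. II §6 no. 2 Prop. 6 (p. 288)] -/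
theorem bilinForm_ext_toTower {B₁ B₂ : LinearMap.BilinForm ℚ_[ℓ] (C.etaleH1Tower ℓ)}
    (h : ∀ (K : C5.SmallLevel C.S.K₀) (φ ψ : C.etaleH1 ℓ K),
      B₁ (C.toTower ℓ K φ) (C.toTower ℓ K ψ) = B₂ (C.toTower ℓ K φ) (C.toTower ℓ K ψ)) :
    B₁ = B₂ := by
  haveI := RestOne.isDirectedOrder_idx C
  haveI := RestOne.nonempty_idx C
  exact bilin_ext_of (f := C.etSys ℓ) fun i x y => h (OrderDual.ofDual i) x y

/-- **Cross-level formula**: if `B ([φ]_K, [ψ]_K) = w K • e K (φ, ψ)` at every level, then for `L ⊆ K, K'` (morphisms `f : L ⟶ K`, `f' : L ⟶ K'`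
of levels) `B ([φ]_K, [ψ]_{K'}) = w L • e L (ᵗV_ℓ(Alb_f) φ, ᵗV_ℓ(Alb_{f'}) ψ)` (push both classes to the common refinement `L`; ★ `toTower_pull`).
Ours. [cite: Liu2021, §4.2 (FJcycle.tex l. 2070–2072 and l. 2158; print pp. 49–50)] -/
theorem bilinForm_toTower_toTower
    {e : ∀ K : C5.SmallLevel C.S.K₀, LinearMap.BilinForm ℚ_[ℓ] (C.etaleH1 ℓ K)} {w : C5.SmallLevel C.S.K₀ → ℚ_[ℓ]}
    {B : LinearMap.BilinForm ℚ_[ℓ] (C.etaleH1Tower ℓ)}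
    (hB : ∀ (K : C5.SmallLevel C.S.K₀) (φ ψ : C.etaleH1 ℓ K), B (C.toTower ℓ K φ) (C.toTower ℓ K ψ) = w K • e K φ ψ)
    {L K K' : C5.SmallLevel C.S.K₀} (f : L ⟶ K) (f' : L ⟶ K') (φ : C.etaleH1 ℓ K) (ψ : C.etaleH1 ℓ K') :
    B (C.toTower ℓ K φ) (C.toTower ℓ K' ψ) =
      w L • e L ((rationalTateModuleMap ℓ (C.Atr f)).dualMap φ) ((rationalTateModuleMap ℓ (C.Atr f')).dualMap ψ) := by
  rw [← C.toTower_pull ℓ f φ, ← C.toTower_pull ℓ f' ψ, hB]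

/-! ## §4 Galois equivariance up to a character -/

/-- **Galois equivariance**: if the level forms are `Γ_E`-equivariant up to a character `χ` (`e K (σφ, σψ) = χ σ • e K (φ, ψ)`, as the `ℓ`-adic
Weil pairing is with `χ = χ_ℓ⁻¹` on `H¹ = (V_ℓ)^∨`), then so is the tower form: `B (σ·x, σ·y) = χ σ • B (x, y)` (`σ · [φ]_K = [σ · φ]_K`,
★ `towerRep_toTower`).  Ours. [cite: Liu2021, §4.2 (FJcycle.tex l. 2158–2160; print pp. 49–50)] -/
theorem bilinForm_towerRep
    {e : ∀ K : C5.SmallLevel C.S.K₀, LinearMap.BilinForm ℚ_[ℓ] (C.etaleH1 ℓ K)} {w : C5.SmallLevel C.S.K₀ → ℚ_[ℓ]}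
    {B : LinearMap.BilinForm ℚ_[ℓ] (C.etaleH1Tower ℓ)}
    (hB : ∀ (K : C5.SmallLevel C.S.K₀) (φ ψ : C.etaleH1 ℓ K), B (C.toTower ℓ K φ) (C.toTower ℓ K ψ) = w K • e K φ ψ)
    (χ : Field.absoluteGaloisGroup E → ℚ_[ℓ])
    (hχ : ∀ (K : C5.SmallLevel C.S.K₀) (σ : Field.absoluteGaloisGroup E) (φ ψ : C.etaleH1 ℓ K),
      e K (C.etaleH1Rep ℓ K σ φ) (C.etaleH1Rep ℓ K σ ψ) = χ σ • e K φ ψ)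
    (σ : Field.absoluteGaloisGroup E) (x y : C.etaleH1Tower ℓ) :
    B (C.towerRep ℓ σ x) (C.towerRep ℓ σ y) = χ σ • B x y := by
  haveI := RestOne.isDirectedOrder_idx C
  haveI := RestOne.nonempty_idx C
  refine bilin_map_map_of (f := C.etSys ℓ) (e := fun i : Idx C => w (OrderDual.ofDual i) • e (OrderDual.ofDual i))
    (fun i φ ψ => hB (OrderDual.ofDual i) φ ψ) _ _ (χ σ) (fun i φ ψ => ?_) x y
  change B (C.towerRep ℓ σ (C.toTower ℓ (OrderDual.ofDual i) φ)) (C.towerRep ℓ σ (C.toTower ℓ (OrderDual.ofDual i) ψ)) = _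
  rw [C.towerRep_toTower, C.towerRep_toTower, hB, hχ, LinearMap.smul_apply, LinearMap.smul_apply, smul_smul, smul_smul,
    mul_comm (w _) (χ σ)]

/-! ## §5 Separation -/

/-- **Left separation**: if every level form is left-separating and the weights are non-zero, the tower form is left-separating
(`B (x, ·) = 0 ⇒ x = 0`; test on the classes of the level of `x`; ★ `bilin_separatingLeft_of`).  Ours.
[cite: Liu2021, §4.2 (FJcycle.tex l. 2158; print pp. 49–50)] [cite: BourbakiAlgebraI1989, Ch. II §6 no. 2 Prop. 3 (p. 286)] -/
theorem bilinForm_separatingLeft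
    {e : ∀ K : C5.SmallLevel C.S.K₀, LinearMap.BilinForm ℚ_[ℓ] (C.etaleH1 ℓ K)} {w : C5.SmallLevel C.S.K₀ → ℚ_[ℓ]}
    {B : LinearMap.BilinForm ℚ_[ℓ] (C.etaleH1Tower ℓ)}
    (hB : ∀ (K : C5.SmallLevel C.S.K₀) (φ ψ : C.etaleH1 ℓ K), B (C.toTower ℓ K φ) (C.toTower ℓ K ψ) = w K • e K φ ψ)
    (hw : ∀ K : C5.SmallLevel C.S.K₀, w K ≠ 0)
    (hnd : ∀ (K : C5.SmallLevel C.S.K₀) (φ : C.etaleH1 ℓ K), (∀ ψ : C.etaleH1 ℓ K, e K φ ψ = 0) → φ = 0)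
    (x : C.etaleH1Tower ℓ) (hx : ∀ y : C.etaleH1Tower ℓ, B x y = 0) : x = 0 := by
  haveI := RestOne.isDirectedOrder_idx C
  haveI := RestOne.nonempty_idx C
  refine bilin_separatingLeft_of (f := C.etSys ℓ) (e := fun i : Idx C => w (OrderDual.ofDual i) • e (OrderDual.ofDual i))
    (fun i φ ψ => hB (OrderDual.ofDual i) φ ψ) (fun i φ hφ => ?_) x hx
  refine hnd _ φ fun ψ => ?_
  have h := hφ ψ
  simp only [LinearMap.smul_apply, smul_eq_zero] at h
  exact h.resolve_left (hw _)

/-- **Right separation**: the mirror statement (`B (·, y) = 0 ⇒ y = 0`).  Ours.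
[cite: Liu2021, §4.2 (FJcycle.tex l. 2158; print pp. 49–50)] [cite: BourbakiAlgebraI1989, Ch. II §6 no. 2 Prop. 3 (p. 286)] -/
theorem bilinForm_separatingRight
    {e : ∀ K : C5.SmallLevel C.S.K₀, LinearMap.BilinForm ℚ_[ℓ] (C.etaleH1 ℓ K)} {w : C5.SmallLevel C.S.K₀ → ℚ_[ℓ]}
    {B : LinearMap.BilinForm ℚ_[ℓ] (C.etaleH1Tower ℓ)}
    (hB : ∀ (K : C5.SmallLevel C.S.K₀) (φ ψ : C.etaleH1 ℓ K), B (C.toTower ℓ K φ) (C.toTower ℓ K ψ) = w K • e K φ ψ)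
    (hw : ∀ K : C5.SmallLevel C.S.K₀, w K ≠ 0)
    (hnd : ∀ (K : C5.SmallLevel C.S.K₀) (ψ : C.etaleH1 ℓ K), (∀ φ : C.etaleH1 ℓ K, e K φ ψ = 0) → ψ = 0)
    (y : C.etaleH1Tower ℓ) (hy : ∀ x : C.etaleH1Tower ℓ, B x y = 0) : y = 0 := by
  haveI := RestOne.isDirectedOrder_idx C
  haveI := RestOne.nonempty_idx C
  refine bilin_separatingRight_of (f := C.etSys ℓ) (e := fun i : Idx C => w (OrderDual.ofDual i) • e (OrderDual.ofDual i))
    (fun i φ ψ => hB (OrderDual.ofDual i) φ ψ) (fun i ψ hψ => ?_) y hy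
  refine hnd _ ψ fun φ => ?_
  have h := hψ φ
  simp only [LinearMap.smul_apply, smul_eq_zero] at h
  exact h.resolve_left (hw _)

/-! ## §6 Symmetry and alternation -/

/-- **Symmetry** passes from the levels to the tower form.  Ours. [cite: Liu2021, §4.2 (FJcycle.tex l. 2158; print pp. 49–50)]
[cite: BourbakiAlgebraI1989, Ch. II §6 no. 3 Prop. 7 (p. 289–290)] -/
theorem bilinForm_comm
    {e : ∀ K : C5.SmallLevel C.S.K₀, LinearMap.BilinForm ℚ_[ℓ] (C.etaleH1 ℓ K)} {w : C5.SmallLevel C.S.K₀ → ℚ_[ℓ]}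
    {B : LinearMap.BilinForm ℚ_[ℓ] (C.etaleH1Tower ℓ)}
    (hB : ∀ (K : C5.SmallLevel C.S.K₀) (φ ψ : C.etaleH1 ℓ K), B (C.toTower ℓ K φ) (C.toTower ℓ K ψ) = w K • e K φ ψ)
    (hs : ∀ (K : C5.SmallLevel C.S.K₀) (φ ψ : C.etaleH1 ℓ K), e K φ ψ = e K ψ φ)
    (x y : C.etaleH1Tower ℓ) : B x y = B y x := by
  haveI := RestOne.isDirectedOrder_idx C
  haveI := RestOne.nonempty_idx C
  exact bilin_comm_of (f := C.etSys ℓ) (e := fun i : Idx C => w (OrderDual.ofDual i) • e (OrderDual.ofDual i))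
    (fun i φ ψ => hB (OrderDual.ofDual i) φ ψ)
    (fun i φ ψ => by rw [LinearMap.smul_apply, LinearMap.smul_apply, LinearMap.smul_apply, LinearMap.smul_apply, hs]) x y

/-- **Alternation** passes from the levels to the tower form (as for the Weil pairings).  Ours. [cite: Liu2021, §4.2 (FJcycle.tex l. 2158; print pp. 49–50)]
[cite: BourbakiAlgebraI1989, Ch. II §6 no. 3 Prop. 7 (p. 289–290)] -/
theorem bilinForm_self_eq_zero
    {e : ∀ K : C5.SmallLevel C.S.K₀, LinearMap.BilinForm ℚ_[ℓ] (C.etaleH1 ℓ K)} {w : C5.SmallLevel C.S.K₀ → ℚ_[ℓ]}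
    {B : LinearMap.BilinForm ℚ_[ℓ] (C.etaleH1Tower ℓ)}
    (hB : ∀ (K : C5.SmallLevel C.S.K₀) (φ ψ : C.etaleH1 ℓ K), B (C.toTower ℓ K φ) (C.toTower ℓ K ψ) = w K • e K φ ψ)
    (ha : ∀ (K : C5.SmallLevel C.S.K₀) (φ : C.etaleH1 ℓ K), e K φ φ = 0)
    (x : C.etaleH1Tower ℓ) : B x x = 0 := by
  haveI := RestOne.isDirectedOrder_idx C
  haveI := RestOne.nonempty_idx C
  exact bilin_self_eq_zero_of (f := C.etSys ℓ) (e := fun i : Idx C => w (OrderDual.ofDual i) • e (OrderDual.ofDual i))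
    (fun i φ ψ => hB (OrderDual.ofDual i) φ ψ)
    (fun i φ => by rw [LinearMap.smul_apply, LinearMap.smul_apply, ha, smul_zero]) x

end Sec42Data

/-! ## §3 Invariance under the Hecke action induced by the translates -/

namespace Sec42Data.HeckeTranslates

variable {C : Sec42Data P5 isotropicAt} (T : C.HeckeTranslates) (ℓ : ℕ) [Fact ℓ.Prime]

open RestOne (Idx)
open scoped Classical

/-- **The tower form is invariant under `𝔾(𝔸_F^∞)`**: if `B ([φ]_K, [ψ]_K) = w K • e K (φ, ψ)` at every level and the level family satisfies
the ONE law `w L • e L (ᵗV_ℓ(Alb T_g) φ, ᵗV_ℓ(Alb T_g) ψ) = w K • e K (φ, ψ)` for every translate `T_g : X_L → X_K` (`g⁻¹Lg ⊆ K`), then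
`B (g·x, g·y) = B (x, y)` for the Hecke action ★ `etHeckeRep` («the Hecke correspondences provide a homomorphism `𝔾(𝔸_F^∞) → Aut_E(A_∞)`»): read
`g · [φ]_K = [ᵗV_ℓ(Alb T_g) φ]_L` at the admissible level `L = gKg⁻¹ ∩ K₀` (★ `etHeckeRep_toTower`, ★ `C5.heckeLE_heckeLevel`) and pass to the
limit (★ `bilin_map_map_of'`).  Ours. [cite: Liu2021, §4.2 (FJcycle.tex l. 2074 and l. 2160; print pp. 49–50)] -/
theorem bilinForm_etHeckeRep
    {e : ∀ K : C5.SmallLevel C.S.K₀, LinearMap.BilinForm ℚ_[ℓ] (C.etaleH1 ℓ K)} {w : C5.SmallLevel C.S.K₀ → ℚ_[ℓ]}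
    {B : LinearMap.BilinForm ℚ_[ℓ] (C.etaleH1Tower ℓ)}
    (hB : ∀ (K : C5.SmallLevel C.S.K₀) (φ ψ : C.etaleH1 ℓ K), B (C.toTower ℓ K φ) (C.toTower ℓ K ψ) = w K • e K φ ψ)
    (hT : ∀ (g : C.G) (L K : C5.SmallLevel C.S.K₀) (hLK : C5.HeckeLE g L K) (φ ψ : C.etaleH1 ℓ K),
      w L • e L ((rationalTateModuleMap ℓ (T.albTr g L K hLK)).dualMap φ)
        ((rationalTateModuleMap ℓ (T.albTr g L K hLK)).dualMap ψ) = w K • e K φ ψ)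
    (g : C.G) (x y : C.etaleH1Tower ℓ) :
    B (T.etHeckeRep ℓ g x) (T.etHeckeRep ℓ g y) = B x y := by
  haveI := RestOne.isDirectedOrder_idx C
  haveI := RestOne.nonempty_idx C
  refine bilin_map_map_of' (f := C.etSys ℓ) (e := fun i : Idx C => w (OrderDual.ofDual i) • e (OrderDual.ofDual i))
    (fun i φ ψ => hB (OrderDual.ofDual i) φ ψ) _ _ (fun i φ ψ => ?_) x y
  change B (T.etHeckeRep ℓ g (C.toTower ℓ (OrderDual.ofDual i) φ)) (T.etHeckeRep ℓ g (C.toTower ℓ (OrderDual.ofDual i) ψ)) = _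
  rw [T.etHeckeRep_toTower ℓ g (C5.heckeLE_heckeLevel g (OrderDual.ofDual i)),
    T.etHeckeRep_toTower ℓ g (C5.heckeLE_heckeLevel g (OrderDual.ofDual i)), hB, hT]
  rfl

/-! ## §7 The packaged socket -/

/-- **«The form on the tower» (∃-form; the (T2) socket of the tower road toward `SocketRos`)**: from a level family `e K` of bilinear forms on
`H¹_ét(A_K) = (V_ℓ A_K)^∨`, weights `w K`, and the ONE law `w L • e L (ᵗV_ℓ(Alb T_g) φ, ᵗV_ℓ(Alb T_g) ψ) = w K • e K (φ, ψ)` for every translate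
`T_g : X_L → X_K` with `g⁻¹Lg ⊆ K` (at `g = 1` the transitions, ★ `albTr_one`), there is a bilinear form `B` on `H¹_ét(A_∞)` with
`B ([φ]_K, [ψ]_K) = w K • e K (φ, ψ)` at every level AND `B (g·x, g·y) = B (x, y)` for every `g ∈ 𝔾(𝔸_F^∞)`.  (Unique by `bilinForm_ext_toTower`;
Galois-`χ`-equivariant / separating / symmetric / alternating by §4–§6 when the levels are.)  Ours.
[cite: Liu2021, §4.2 (FJcycle.tex l. 2070–2074 and l. 2158–2160; print pp. 49–50)] [cite: BourbakiAlgebraI1989, Ch. II §6 no. 3 Prop. 7 (p. 289–290)] -/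
theorem exists_bilinForm_etaleH1Tower
    (e : ∀ K : C5.SmallLevel C.S.K₀, LinearMap.BilinForm ℚ_[ℓ] (C.etaleH1 ℓ K)) (w : C5.SmallLevel C.S.K₀ → ℚ_[ℓ])
    (hT : ∀ (g : C.G) (L K : C5.SmallLevel C.S.K₀) (hLK : C5.HeckeLE g L K) (φ ψ : C.etaleH1 ℓ K),
      w L • e L ((rationalTateModuleMap ℓ (T.albTr g L K hLK)).dualMap φ)
        ((rationalTateModuleMap ℓ (T.albTr g L K hLK)).dualMap ψ) = w K • e K φ ψ) :
    ∃ B : LinearMap.BilinForm ℚ_[ℓ] (C.etaleH1Tower ℓ),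
      (∀ (K : C5.SmallLevel C.S.K₀) (φ ψ : C.etaleH1 ℓ K), B (C.toTower ℓ K φ) (C.toTower ℓ K ψ) = w K • e K φ ψ) ∧
      ∀ (g : C.G) (x y : C.etaleH1Tower ℓ), B (T.etHeckeRep ℓ g x) (T.etHeckeRep ℓ g y) = B x y := by
  obtain ⟨B, hB⟩ := C.exists_bilinForm_toTower ℓ e w (fun f φ ψ => by
    have h := hT 1 _ _ (C5.HeckeLE.one_of_le f.le) φ ψ
    rwa [T.albTr_one f] at h)
  exact ⟨B, hB, fun g x y => T.bilinForm_etHeckeRep ℓ hB hT g x y⟩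

end Sec42Data.HeckeTranslates

end Literature.NumberTheory.Automorphic.Liu2021.AppendixC
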